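import Literature.Barriers.NavierStokesRegularity.GalileanFrameSlotFamily
import Mathlib.Analysis.SpecialFunctions.SmoothTransition
import HarnessLib

/-!
# Barrier: the Galilean frame slot on `ℝ³` — uniform accelerating streams are classical
# Navier–Stokes solutions, so no frame-dependent pointwise law and no decay-free uniqueness /
# a-priori bound survives (Majda–Bertozzi 2002 §1.2; Tao 2013 §3 eq. (galilean); Fefferman (4), (7))

Barrier catalogue entry for `NavierStokesRegularity` (D-0021), filed by the D-0090 NS-CLAIMS cell
(salvage seat `ns-claims-salvage-p6`) at the METHOD level; it is the `ℝ³` companion of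
`UnnormalisedPressureLoophole` (which records the PERIODIC form of the same symmetry, Tao's
"technical loophole of non-periodic pressure"). Gap seed G5 «Galilean frame slot on ℝ³» of the
cell's COUNTERMODEL-INDEX §6 (witness family W3). Cell rows whose first failing step was located by
a member of this family (locators, not authors): `Literature.Claims.NS.RomanMiller2011.Step_general`
(C51), `Literature.Claims.NS.Ershkov2015.Step_24` (C52), `Literature.Claims.NS.UmarBisandu2025.Step1_MinimumForce`
(C60); scalar / function-space faces of the same family: `Literature.Claims.NS.Jha2018.Step1_EnergyLaw`
(C65), `Literature.Claims.NS.Davlatov2020.Step3_TimeDerivL1` (C76); covariance used positively: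
`Literature.Claims.NS.Martila2023.Step_2` (C59); periodic twin: `Literature.Claims.NS.Jormakka2010.Step24UniqueLocal`
(C02, via `UnnormalisedPressureLoophole`).

## What is printed

* Majda–Bertozzi 2002, §1.2 (symmetry groups of the Euler and the Navier–Stokes equations):
  Galilean invariance `u ↦ u(x − tV, t) + V` (any velocity `V`), translation, rotation and scale
  invariance of the solution set. [MajdaBertozzi2002]
* Tao, Anal. PDE 6 (2013) §3 eq. (galilean): the extended (accelerated-frame) symmetry
  `ũ(t,x) = u(t, x − ∫₀ᵗ v) + v(t)`, `p̃(t,x) = p(t, x − ∫₀ᵗ v) − x · v′(t)`, "valid for any smooth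
  function `v : ℝ → ℝ³`". [Tao2013Localisation] (Tree: `IsClassicalNSSolutionOn.galileanBoost`.)
* Fefferman's Clay text: the solution class of (A)/(C) is (1), (2), (3), (6) AND the energy bound
  (7) `∫|u(x,t)|² dx < C`; the datum class is (4). [FeffermanClay2006]

## What is formalised (everything is a theorem of the tree, standard axioms)

Family file `GalileanFrameSlotFamily.lean` (namespace `…NavierStokesRegularity.FrameSlot`): on any
finite-dimensional real inner-product space `E` (so `ℝ³`), for every viscosity `ν` and every
SMOOTH velocity profile `a : ℝ → E`, the uniform stream `u(t, y) = a(t)` with pressure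
`p(t, y) = −⟪a′(t), y⟫` — the extended-Galilean image of the rest state — is an unforced classical
solution on every time set of unique differentiability (`FrameSlot.isClassicalNSSolutionOn_stream`),
in particular on all of space-time and on `[0,∞)` (Clay predicates (1)(2)(3)(6):
`FrameSlot.isNavierStokesSolution_stream`). Along it `∂ₜu = a′(t)` and `∇p = −a′(t)` take EVERY
vector value while `(u·∇)u = 0`, `Δu = 0`, `div u = 0`, `Du = 0`, `∇(|u|²/2) = 0`; hence
`FrameSlot.slot` — THE SLOT: a relation among the point values of
`(u, ∂ₜu, (u·∇)u, Δu, ∇p, ∇(|u|²/2))` asserted for ALL unforced classical solutions on a time set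
`S ∋ t₀` of unique differentiability must hold at `(c, b, 0, 0, −b, 0)` for all vectors `b, c` —
with corollaries `no_pointwise_bernoulli_law` (no law `∇p = −∇(|u|²/2)`),
`no_constant_inertial_force` (`∂ₜu + (u·∇)u` is not one constant),
`no_autonomous_time_derivative_law` (`∂ₜu` is not a function of the spatial jet `(u, Du, Δu)`),
`materialDeriv_onto`; and `FrameSlot.not_hasBoundedEnergy_stream`,
`FrameSlot.eq_zero_of_hasRapidSpatialDecay_stream` — what removes the family from Clay (A)/(C) is
EXACTLY Fefferman's (7) (and (4) for the datum): every stream moving at some `t ≥ 0` has infinite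
energy. This file adds the zero-datum consequences and the catalogue entry:
* `FrameSlot.setOf_smoothSolution_zero_datum_infinite` — from the ZERO datum with ZERO force
  there are infinitely many solutions of (1)(2)(3)(6) on `E × [0,∞)` (`E` nontrivial);
* `FrameSlot.exists_isMaximalSmoothSolution_zero_datum` — for every `T > 0` a classical solution
  on `[0,T)` from the zero datum with `‖u(t,y)‖ → ∞` as `t → T⁻` and NO smooth extension past `T`
  (`IsMaximalSmoothSolution`), while the rest state is global; `exists_global_solution_zero_datum_large`
  — global solutions from the zero datum of any prescribed size at any `t₁ > 0`: so no a-priori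
  bound `sup|u(t)| ≤ F(u₀, t)` and no continuation / uniqueness statement for classical solutions
  holds on `ℝ³` without a decay, energy or pressure class;
* `FrameSlot.exists_solution_vanishing_for_nonpos_time` — a global classical solution on all of
  space-time that is the rest state for `t ≤ 0` and non-zero at `t = 1` (no time-analytic /
  entire-series "general solution", no unique continuation from rest in the decay-free class).
`GalileanFrameSlot` packages these on `ℝ³`; `galileanFrameSlot_holds` proves it.

## References

* [MajdaBertozzi2002] A. J. Majda, A. L. Bertozzi, *Vorticity and Incompressible Flow*, CUP 2002,
  §1.2 (Galilean invariance of the Navier–Stokes equations).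
* [Tao2013Localisation] T. Tao, Anal. PDE 6 (2013) 25–107 = arXiv:1108.1165, §3 eq. (galilean).
* [FeffermanClay2006] C. L. Fefferman, CMI problem description, (A)/(C) with (4), (6), (7).

WHAT THIS IS NOT: not a claim about NS regularity or blow-up; not a claim about any author beyond the
typed locator.
-/

noncomputable section

open Set Function Filter InnerProductSpace MeasureTheory
open scoped ContDiff RealInnerProductSpace Topology Laplacian ENNReal

namespace Literature.Barriers.NavierStokesRegularity

open Literature.Analysis.FluidPDE

namespace FrameSlot

variable {E : Type*} [NormedAddCommGroup E] [InnerProductSpace ℝ E] [FiniteDimensional ℝ E]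

/-! ### Zero datum: non-uniqueness, unbounded growth, finite lifespan — all without (7) -/

omit [FiniteDimensional ℝ E] in
/-- The linear profile `a(t) = (c t) w` is smooth. [cite: Tao2013Localisation, §3 eq. (galilean)] -/
theorem contDiff_linearProfile (c : ℝ) (w : E) : ContDiff ℝ ∞ (fun t : ℝ => (c * t) • w) :=
  (contDiff_const.mul contDiff_id).smul contDiff_const

/-- **Infinitely many global smooth solutions from the ZERO datum** (`E` nontrivial): for every
`ν` the set of pairs `(u, p)` smooth on `E × [0,∞)` solving Fefferman's (1), (2), (3) with
`f ≡ 0`, `u₀ ≡ 0` is infinite — it contains the uniform streams `u = (ct) w`, `p = −c⟪w, y⟫`,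
`c ∈ ℝ`. (Periodic twin: `setOf_periodicSolution_infinite`.) [cite: Tao2013Localisation, §3 eq. (galilean)] -/
theorem setOf_smoothSolution_zero_datum_infinite [Nontrivial E] (ν : ℝ) :
    {q : (ℝ → E → E) × (ℝ → E → ℝ) |
      IsSmoothOnHalfSpace q.1 ∧ IsSmoothOnHalfSpace q.2 ∧ IsNavierStokesSolution ν 0 0 q.1 q.2}.Infinite := by
  obtain ⟨w, hw⟩ := exists_ne (0 : E)
  refine infinite_of_injective_forall_mem
    (f := fun c : ℝ => ((fun t (_ : E) => (c * t) • w),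
      (fun t (y : E) => -⟪deriv (fun s : ℝ => (c * s) • w) t, y⟫))) ?_ ?_
  · intro c₁ c₂ h
    have hv := congrArg (fun q : (ℝ → E → E) × (ℝ → E → ℝ) => q.1 1 0) h
    simp only [mul_one] at hv
    exact smul_left_injective ℝ hw hv
  · intro c
    obtain ⟨h1, h2, h3⟩ := isNavierStokesSolution_stream (contDiff_linearProfile c w) ν
    refine ⟨h2, h3, ?_⟩
    have h0 : (fun _ : E => (fun t : ℝ => (c * t) • w) 0) = (0 : E → E) := by
      funext y
      simp
    rw [h0] at h1
    exact h1

omit [FiniteDimensional ℝ E] in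
/-- **A jointly smooth field on `[0, T') × E` does not blow up at an interior time `T < T'`.**
[cite: FeffermanClay2006, eqs. (6) (11)] -/
theorem not_tendsto_norm_atTop_of_isSmoothSpaceTimeOn {F : Type*} [NormedAddCommGroup F]
    [NormedSpace ℝ F] {w : ℝ → E → F} {T T' : ℝ} (hw : IsSmoothSpaceTimeOn (Ico 0 T') w)
    (hT : 0 < T) (hTT' : T < T') (y : E) :
    ¬ Tendsto (fun t => ‖w t y‖) (𝓝[<] T) atTop := by
  intro hlim
  have hmem : T ∈ Ico 0 T' := ⟨hT.le, hTT'⟩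
  have hcont : ContinuousWithinAt (fun t => ‖w t y‖) (Ico 0 T') T := by
    have h1 : ContinuousOn (uncurry w) (Ico (0 : ℝ) T' ×ˢ univ) := hw.continuousOn
    have h2 : ContinuousWithinAt (uncurry w) (Ico (0 : ℝ) T' ×ˢ univ) ((fun t : ℝ => (t, y)) T) :=
      h1 (T, y) ⟨hmem, mem_univ _⟩
    have h3 : ContinuousWithinAt (fun t : ℝ => (t, y)) (Ico 0 T') T :=
      (continuous_id.prodMk continuous_const).continuousWithinAt
    exact (ContinuousWithinAt.comp (f := fun t : ℝ => (t, y)) (x := T) h2 h3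
      fun t ht => ⟨ht, mem_univ _⟩).norm
  haveI : (𝓝[Ioo 0 T] T).NeBot := right_nhdsWithin_Ioo_neBot hT
  have hsub1 : 𝓝[Ioo 0 T] T ≤ 𝓝[Ico 0 T'] T :=
    nhdsWithin_mono T fun t ht => ⟨ht.1.le, ht.2.trans hTT'⟩
  have hsub2 : 𝓝[Ioo 0 T] T ≤ 𝓝[<] T := nhdsWithin_mono T fun t ht => ht.2
  exact not_tendsto_nhds_of_tendsto_atTop (hlim.mono_left hsub2) _ (hcont.tendsto.mono_left hsub1)

/-- **Finite lifespan from the zero datum, zero force** (`E` nontrivial): for every `ν` and every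
`T > 0` there is a MAXIMAL smooth solution with lifespan exactly `T` issued from `u₀ ≡ 0` — the
accelerated rest frame `u(t) = −(1/(T−t) − 1/T) w`, `p = (T−t)⁻² ⟪w, y⟫` (tree
`isClassicalNSSolutionOn_acceleratedRest`), whose speed tends to `∞` as `t → T⁻` and whose velocity
slices are spatially constant; meanwhile the rest state solves the same Cauchy problem globally.
Hence no a-priori bound of `sup|u(t)|` by the datum and no continuation criterion holds for
classical solutions on `E = ℝ³` without a decay / energy / pressure-growth class.
[cite: Tao2013Localisation, §3 eq. (galilean)] -/
theorem exists_isMaximalSmoothSolution_zero_datum [Nontrivial E] (ν : ℝ) {T : ℝ} (hT : 0 < T) :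
    ∃ (u : ℝ → E → E) (p : ℝ → E → ℝ), IsMaximalSmoothSolution ν 0 u p T ∧ u 0 = 0 ∧
      (∀ t ∈ Ico 0 T, ∀ y, fderiv ℝ (u t) y = 0) ∧
      ∀ y, Tendsto (fun t => ‖u t y‖) (𝓝[<] T) atTop := by
  obtain ⟨w, hw⟩ := exists_ne (0 : E)
  refine ⟨fun t _ => -(1 / (T - t) - 1 / T) • w, fun t y => (1 / (T - t) ^ 2) * ⟪w, y⟫,
    ⟨isClassicalNSSolutionOn_acceleratedRest ν w, ?_⟩, ?_, ?_, fun y => tendsto_norm_acceleratedRest T hw y⟩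
  · rintro ⟨T', hTT', u', p', hu', hagree⟩
    refine not_tendsto_norm_atTop_of_isSmoothSpaceTimeOn hu'.smooth_velocity hT hTT' 0 ?_
    refine (tendsto_norm_acceleratedRest T hw (0 : E)).congr' ?_
    filter_upwards [Ioo_mem_nhdsLT hT] with t ht
    rw [hagree t ⟨ht.1.le, ht.2⟩]
  · funext y
    simp
  · intro t _ y
    rw [fderiv_const_apply]

/-- **Unbounded growth from the zero datum among GLOBAL solutions**: for every `ν`, `M` and
`t₁ > 0` there is a solution of (1)(2)(3)(6) on `E × [0,∞)` with `u₀ ≡ 0`, `f ≡ 0` and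
`‖u(t₁, 0)‖ > M` (`E` nontrivial): the linear stream `u = (ct) w`. [cite: Tao2013Localisation, §3 eq. (galilean)] -/
theorem exists_global_solution_zero_datum_large [Nontrivial E] (ν M : ℝ) {t₁ : ℝ} (ht₁ : 0 < t₁) :
    ∃ (u : ℝ → E → E) (p : ℝ → E → ℝ), IsSmoothOnHalfSpace u ∧ IsSmoothOnHalfSpace p ∧
      IsNavierStokesSolution ν 0 0 u p ∧ M < ‖u t₁ 0‖ := by
  obtain ⟨w, hw⟩ := exists_ne (0 : E)
  have hw' : 0 < ‖w‖ := norm_pos_iff.2 hw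
  set c : ℝ := (|M| + 1) / (t₁ * ‖w‖) with hc
  obtain ⟨h1, h2, h3⟩ := isNavierStokesSolution_stream (contDiff_linearProfile c w) ν
  refine ⟨_, _, h2, h3, ?_, ?_⟩
  · have h0 : (fun _ : E => (fun t : ℝ => (c * t) • w) 0) = (0 : E → E) := by
      funext y
      simp
    rw [h0] at h1
    exact h1
  · have hcpos : 0 < c := by rw [hc]; positivity
    have hval : ‖(fun (t : ℝ) (_ : E) => (c * t) • w) t₁ 0‖ = |M| + 1 := by
      show ‖(c * t₁) • w‖ = |M| + 1
      rw [norm_smul, Real.norm_of_nonneg (mul_pos hcpos ht₁).le, hc]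
      field_simp
    rw [hval]
    exact (le_abs_self M).trans_lt (lt_add_one _)

/-! ### Time profile: the rest state for `t ≤ 0`, moving at `t = 1` -/

/-- **A global classical solution on all of space-time which is the rest state for `t ≤ 0` and
non-zero at `t = 1`** (profile `expNegInvGlue`, zero force, any `ν`; `E` nontrivial). So the
unforced system has, in the decay-free classical class, no unique continuation from rest and no
representation of «the general solution» by functions real-analytic (let alone entire) in `t` —
the shape of `Literature.Claims.NS.RomanMiller2011.Step_general`. [cite: Tao2013Localisation, §3 eq. (galilean)] -/
theorem exists_solution_vanishing_for_nonpos_time [Nontrivial E] (ν : ℝ) :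
    ∃ (u : ℝ → E → E) (p : ℝ → E → ℝ), IsClassicalNSSolutionOn univ ν 0 u p ∧
      (∀ t ≤ 0, u t = 0 ∧ p t = 0) ∧ u 1 ≠ 0 := by
  obtain ⟨w, hw⟩ := exists_ne (0 : E)
  have ha : ContDiff ℝ ∞ (fun t : ℝ => expNegInvGlue t • w) :=
    expNegInvGlue.contDiff.smul contDiff_const
  -- the profile has zero derivative at every `t ≤ 0` (global minimum of the non-negative glue)
  have hglue : ∀ t ≤ (0 : ℝ), deriv expNegInvGlue t = 0 := fun t ht => by
    have hmin : IsLocalMin expNegInvGlue t :=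
      Filter.Eventually.of_forall fun s => by
        rw [expNegInvGlue.zero_of_nonpos ht]
        exact expNegInvGlue.nonneg s
    exact hmin.deriv_eq_zero
  have hd : ∀ t ≤ (0 : ℝ), deriv (fun s : ℝ => expNegInvGlue s • w) t = 0 := fun t ht => by
    rw [((((expNegInvGlue.contDiff (n := 1)).differentiable one_ne_zero) t).hasDerivAt.smul_const w).deriv,
      hglue t ht, zero_smul]
  refine ⟨fun t _ => expNegInvGlue t • w, fun t y => -⟪deriv (fun s : ℝ => expNegInvGlue s • w) t, y⟫,
    isClassicalNSSolutionOn_stream_univ ha ν, fun t ht => ⟨?_, ?_⟩, ?_⟩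
  · funext y
    simp [expNegInvGlue.zero_of_nonpos ht]
  · funext y
    simp [hd t ht]
  · intro h
    have := congrFun h 0
    rw [Pi.zero_apply, smul_eq_zero] at this
    rcases this with h1 | h1
    · exact (expNegInvGlue.pos_of_pos one_pos).ne' h1
    · exact hw h1

end FrameSlot

/-! ### The catalogue entry -/

open FrameSlot

/-- **Barrier (Majda–Bertozzi 2002 §1.2; Tao 2013 §3 eq. (galilean); Fefferman (4), (7)): the
Galilean frame slot on `ℝ³`.** Conjunction of: (i) for every `ν` and every smooth `a : ℝ → ℝ³`
the uniform stream `u = a(t)`, `p = −⟪a′(t), y⟫` is an unforced classical solution on all of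
space-time and satisfies Fefferman's (1)(2)(3)(6) on `ℝ³ × [0,∞)` with datum `a(0)`; (ii) THE SLOT
on `[0,∞)`: a relation among `(u, ∂ₜu, (u·∇)u, Δu, ∇p, ∇(|u|²/2))` that holds pointwise for all
unforced classical solutions on `[0,∞)` holds at `(c, b, 0, 0, −b, 0)` for all `b, c`; (iii) from
the zero datum with zero force: infinitely many solutions of (1)(2)(3)(6) on `ℝ³ × [0,∞)`, and for
every `T > 0` a maximal smooth solution of lifespan `T` with `‖u(t,y)‖ → ∞`; (iv) a global
classical solution that is the rest state for `t ≤ 0` and non-zero at `t = 1`; (v) every stream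
moving at some `t ≥ 0` violates (7), and a stream datum obeys (4) only if it is `0`.
[cite: MajdaBertozzi2002, §1.2]

BARRIER (structured block, D-0021):
technique_class: frame-dependent-pointwise-law bernoulli-pressure-law pressure-determined-by-velocity time-derivative-determined-by-spatial-jet constant-force-axiom general-solution-formula entire-series-representation decay-free-uniqueness decay-free-apriori-sup-bound decay-free-continuation-criterion galilean-noncovariance-complaint
blocks: (a) every identity or inequality among the point values of `u, ∂ₜu, (u·∇)u, Δu, ∇p, ∇|u|²` asserted for ALL classical solutions (no decay / energy / pressure class printed) that fails at `(u, ∂ₜu, (u·∇)u, Δu, ∇p, ∇(|u|²/2)) = (c, b, 0, 0, −b, 0)` for some vectors `b, c` — conjunct (ii); adjudicated shapes: `∇p = −∇φ − ½∇|u|²` (`Literature.Claims.NS.Ershkov2015.Step_24`, drift `u = t e₁`), «each force-per-volume term is a constant» (`Literature.Claims.NS.UmarBisandu2025.Step1_MinimumForce`, `u = t² e₀`), `∂ₜu = −∇(H + |u|²/2) + …` with `∂ₜu` read off the velocity field (`no_autonomous_time_derivative_law`) [cite: MajdaBertozzi2002, §1.2]; (b) every «exact general solution» / representation formula forcing real-analytic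 or polynomial time dependence, or a finite-dimensional ansatz, on ALL classical solutions (`Literature.Claims.NS.RomanMiller2011.Step_general`) — conjunct (iv), profile `expNegInvGlue` [cite: Tao2013Localisation, §3 eq. (galilean)]; (c) every uniqueness, unique-continuation, continuation-criterion or a-priori `sup|u(t)| ≤ F(u₀, t)` statement for classical solutions on `ℝ³` whose hypotheses name no decay, energy or pressure-growth class — conjunct (iii): the zero datum already carries infinitely many global solutions, arbitrarily large ones, and maximal ones of every finite lifespan [cite: Tao2013Localisation, §3 eq. (galilean)]; (d) every argument toward (A) or (C) that never invokes Fefferman's (7) (or an equivalent decay / integrability / pressure normalisation): such an argument cannot separate the rest state from an accelerating stream with the same datum `0` — conjunct (v) says (7) is the ONLY Clay clause the moving streams violate [cite: FeffermanClay2006, eq. (7)]; (e) conversely, a complaint that (1)–(3) are NOT Galilean covariant (`Literature.Claims.NS.Martila2023.Step_2`) — the covariance is the tree theorem `IsClassicalNSSolutionOn.galileanBoost` [cite: MajdaBertozzi2002, §1.2].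
because: the incompressible system is covariant under time-dependent translations `y = x − ξ(t)`, `u ↦ u − ξ′`, `p ↦ p + ⟪ξ″, y⟫` [cite: Tao2013Localisation, §3 eq. (galilean)]; applied to the rest state this produces, for EVERY smooth velocity profile `a`, the classical solution `u = a(t)`, `p = −⟪a′(t), y⟫`, along which `∂ₜu = −∇p = a′(t)` is arbitrary while every spatial derivative of `u` vanishes; the streams have spatially constant, non-decaying velocity and a pressure linear in `y`, hence infinite energy — they live in the printed classical class (1)(2)(3)(6) but not in (7) [cite: FeffermanClay2006, eq. (7)].
evasions_known: (1) impose Fefferman's (7) / finite energy, or `u(t,·) → 0` at infinity, or `p ∈ L¹_loc` with sublinear growth / `p` given by the Riesz-transform formula `p = (−Δ)⁻¹∂ᵢ∂ⱼ(uᵢuⱼ)`: each removes every moving stream (conjunct (v)); in the Leray–Hopf / mild / Kato classes the pressure normalisation is built in and uniqueness of smooth solutions holds (tree: `ClayClassLerayHopfUniqueness`, `kato_unique_holds`) [cite: FeffermanClay2006, eq. (7)]; (2) state pointwise laws covariantly (in terms of `∂ₜu + (u·∇)u + ∇p − νΔu`, vorticity, or frame-invariant quantities) — the slot then returns `b − b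 = 0` and says nothing [cite: MajdaBertozzi2002, §1.2]; (3) the family is kinematically trivial (`Du ≡ 0`, `ω ≡ 0`): it tests frame dependence only and carries no information about vortex stretching, energy transfer or any genuinely nonlinear mechanism — passing the slot is necessary, never sufficient [cite: MajdaBertozzi2002, §1.2].
scope_caveats: (a) unforced system (`f ≡ 0`), any real `ν` (the viscous term vanishes on the family), any finite-dimensional `E` (nontrivial where a non-zero vector is needed); (b) classical pointwise solutions in the tree sense `IsClassicalNSSolutionOn` (one-sided time derivative within the time set) and Fefferman's (1)(2)(3)(6) via `isNavierStokesSolution_and_smooth_iff`; nothing is said about weak or mild formulations, where the streams are not admissible; (c) the «blow-up» in conjunct (iii) is kinematic (a frame acceleration), not a statement about vorticity or any Galilean-invariant quantity, all of which vanish identically on the family; (d) the periodic reading of the same family (velocity constant ⇒ periodic, pressure not) is the separate entry `UnnormalisedPressureLoophole` [cite: Tao2013Localisation, §3 eq. (galilean)].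
status: established; every conjunct proved in the tree (`galileanFrameSlot_holds`, standard axioms) -/
def GalileanFrameSlot : Prop :=
  (∀ (ν : ℝ) (a : ℝ → EuclideanSpace ℝ (Fin 3)), ContDiff ℝ ∞ a →
      IsClassicalNSSolutionOn univ ν 0 (fun t _ => a t) (fun t y => -⟪deriv a t, y⟫) ∧
        IsNavierStokesSolution ν 0 (fun _ => a 0) (fun t _ => a t) (fun t y => -⟪deriv a t, y⟫) ∧
          IsSmoothOnHalfSpace (fun t (_ : EuclideanSpace ℝ (Fin 3)) => a t) ∧
            IsSmoothOnHalfSpace (fun (t : ℝ) (y : EuclideanSpace ℝ (Fin 3)) => -⟪deriv a t, y⟫)) ∧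
  (∀ (ν : ℝ) (R : EuclideanSpace ℝ (Fin 3) → EuclideanSpace ℝ (Fin 3) → EuclideanSpace ℝ (Fin 3) →
      EuclideanSpace ℝ (Fin 3) → EuclideanSpace ℝ (Fin 3) → EuclideanSpace ℝ (Fin 3) → Prop),
      (∀ (u : ℝ → EuclideanSpace ℝ (Fin 3) → EuclideanSpace ℝ (Fin 3))
          (p : ℝ → EuclideanSpace ℝ (Fin 3) → ℝ), IsClassicalNSSolutionOn (Ici 0) ν 0 u p →
          ∀ t ∈ Ici (0 : ℝ), ∀ y, R (u t y) (timeDerivWithin (Ici 0) u t y) (convect (u t) (u t) y)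
            ((Δ (u t)) y) (gradient (p t) y) (gradient (fun z => ‖u t z‖ ^ 2 / 2) y)) →
        ∀ b c, R c b 0 0 (-b) 0) ∧
  (∀ ν : ℝ,
      {q : (ℝ → EuclideanSpace ℝ (Fin 3) → EuclideanSpace ℝ (Fin 3)) × (ℝ → EuclideanSpace ℝ (Fin 3) → ℝ) |
          IsSmoothOnHalfSpace q.1 ∧ IsSmoothOnHalfSpace q.2 ∧ IsNavierStokesSolution ν 0 0 q.1 q.2}.Infinite ∧
        ∀ T : ℝ, 0 < T → ∃ (u : ℝ → EuclideanSpace ℝ (Fin 3) → EuclideanSpace ℝ (Fin 3))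
          (p : ℝ → EuclideanSpace ℝ (Fin 3) → ℝ), IsMaximalSmoothSolution ν 0 u p T ∧ u 0 = 0 ∧
            ∀ y, Tendsto (fun t => ‖u t y‖) (𝓝[<] T) atTop) ∧
  (∀ ν : ℝ, ∃ (u : ℝ → EuclideanSpace ℝ (Fin 3) → EuclideanSpace ℝ (Fin 3))
      (p : ℝ → EuclideanSpace ℝ (Fin 3) → ℝ), IsClassicalNSSolutionOn univ ν 0 u p ∧
        (∀ t ≤ 0, u t = 0 ∧ p t = 0) ∧ u 1 ≠ 0) ∧
  (∀ (a : ℝ → EuclideanSpace ℝ (Fin 3)),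
      (∀ t, 0 ≤ t → a t ≠ 0 → ¬ HasBoundedEnergy (fun s (_ : EuclideanSpace ℝ (Fin 3)) => a s)) ∧
        (HasRapidSpatialDecay (fun _ : EuclideanSpace ℝ (Fin 3) => a 0) → a 0 = 0))

/-- **The barrier holds** (every conjunct is one of the `FrameSlot.*` theorems above, on
`E = ℝ³`). [cite: MajdaBertozzi2002, §1.2] -/
theorem galileanFrameSlot_holds : GalileanFrameSlot := by
  refine ⟨fun ν a ha => ⟨isClassicalNSSolutionOn_stream_univ ha ν, isNavierStokesSolution_stream ha ν⟩,
    fun ν R hR b c => slot (uniqueDiffOn_Ici 0) (t₀ := 0) (by simp) hR b c,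
    fun ν => ⟨setOf_smoothSolution_zero_datum_infinite ν, fun T hT => ?_⟩,
    fun ν => exists_solution_vanishing_for_nonpos_time ν,
    fun a => ⟨fun t ht hat => not_hasBoundedEnergy_stream ht hat,
      fun h => eq_zero_of_hasRapidSpatialDecay_stream h⟩⟩
  obtain ⟨u, p, hmax, h0, -, hlim⟩ :=
    exists_isMaximalSmoothSolution_zero_datum (E := EuclideanSpace ℝ (Fin 3)) ν hT
  exact ⟨u, p, hmax, h0, hlim⟩

/-- `GalileanFrameSlot` — `_holds` alias of `galileanFrameSlot_holds` above under the fact's exact name (appended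
2026-08-28, D-0026 bookkeeping: the proof term is the existing theorem of this file; no statement,
definition or attribute is edited; no new named fact; the ledger's debt table listed the fact
unproved). [cite: MajdaBertozzi2002, §1.2] -/
theorem _root_.Literature.Barriers.NavierStokesRegularity.GalileanFrameSlot_holds :
    GalileanFrameSlot :=
  _root_.Literature.Barriers.NavierStokesRegularity.galileanFrameSlot_holds

/-- Projection (ii), the slot on `[0,∞)`. [cite: MajdaBertozzi2002, §1.2] -/
theorem GalileanFrameSlot.slot_Ici (h : GalileanFrameSlot) {ν : ℝ}
    {R : EuclideanSpace ℝ (Fin 3) → EuclideanSpace ℝ (Fin 3) → EuclideanSpace ℝ (Fin 3) →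
      EuclideanSpace ℝ (Fin 3) → EuclideanSpace ℝ (Fin 3) → EuclideanSpace ℝ (Fin 3) → Prop}
    (hR : ∀ (u : ℝ → EuclideanSpace ℝ (Fin 3) → EuclideanSpace ℝ (Fin 3))
        (p : ℝ → EuclideanSpace ℝ (Fin 3) → ℝ), IsClassicalNSSolutionOn (Ici 0) ν 0 u p →
        ∀ t ∈ Ici (0 : ℝ), ∀ y, R (u t y) (timeDerivWithin (Ici 0) u t y) (convect (u t) (u t) y)
          ((Δ (u t)) y) (gradient (p t) y) (gradient (fun z => ‖u t z‖ ^ 2 / 2) y))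
    (b c : EuclideanSpace ℝ (Fin 3)) : R c b 0 0 (-b) 0 :=
  h.2.1 ν R hR b c

/-- Projection (iii): the zero datum has infinitely many global smooth solutions of (1)(2)(3)(6),
`f ≡ 0`, on `ℝ³`. [cite: Tao2013Localisation, §3 eq. (galilean)] -/
theorem GalileanFrameSlot.zero_datum_nonunique (h : GalileanFrameSlot) (ν : ℝ) :
    {q : (ℝ → EuclideanSpace ℝ (Fin 3) → EuclideanSpace ℝ (Fin 3)) × (ℝ → EuclideanSpace ℝ (Fin 3) → ℝ) |
        IsSmoothOnHalfSpace q.1 ∧ IsSmoothOnHalfSpace q.2 ∧ IsNavierStokesSolution ν 0 0 q.1 q.2}.Infinite :=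
  (h.2.2.1 ν).1

/-- Projection (v): Fefferman's (7) removes every moving stream. [cite: FeffermanClay2006, eq. (7)] -/
theorem GalileanFrameSlot.energy_excludes (h : GalileanFrameSlot) {a : ℝ → EuclideanSpace ℝ (Fin 3)}
    {t : ℝ} (ht : 0 ≤ t) (hat : a t ≠ 0) :
    ¬ HasBoundedEnergy (fun s (_ : EuclideanSpace ℝ (Fin 3)) => a s) :=
  (h.2.2.2.2 a).1 t ht hat

end Literature.Barriers.NavierStokesRegularity

end
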